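import Summits.QuantumFields.YangMills.Theorems.UnitScaleTiltProp7JointRowTowerData
import Summits.QuantumFields.YangMills.Theorems.UnitScaleTiltProp7FibreLogRatioGaugedL1
import Summits.QuantumFields.YangMills.Theorems.UnitScaleTiltProp7LogRemainderMass
import Summits.QuantumFields.YangMills.Theorems.UnitScaleTiltProp7FibreLevelMassPerLevelT3
import Summits.QuantumFields.YangMills.Theorems.UnitScaleTiltProp7JointRowOfLevelMasses
import Summits.QuantumFields.YangMills.Theorems.UnitScaleTiltProp7RelPlaqVsCovCurl
import Summits.QuantumFields.YangMills.Theorems.UnitScaleTiltProp7AxialLemma1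
import HarnessLib

/-!
# Route `UnitScaleTilt`, crux K1 «MinimiserStabilityRegPr» (stmt-QuantumFields-19200), (n3)∕E′∕EX growth side, file F5 —
# THE JOINT REMAINDER ROW MODULO COARSE PURE GAUGES, DISCHARGED AT AN UNTWISTED CHART POINT:
# `∃ μ 𝔰𝔲(2)-valued, Σ_c‖(Q^{(K−n)}_W(iD))(c) − (μ(c₋) − W̄(c)μ(c₊)W̄(c)*)‖ ≤ C₁·ℓ⁻¹·Σ_b‖D(b)‖² + C₂·ℓ·(Σ_p‖ℒ_p(D)‖² + Σ_x‖D^*_W(iD)(x)‖²_HS)`, L-only `C₁, C₂`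

Cell `ym3-torus`, width seat `ym-ust-19200-w4` (gen 5); ★p1-19200 g14's NAMED file F5 («w4: GO (o4)» 2026-08-28 15:58Z: «OUTPUT = the JOINT conjunct of ✓p645944 §2 LETTER FOR
LETTER … UNTWISTED reading … consume F4b, do not re-derive»).  THEOREMS ONLY (0 `def`, 0 `sorry`); `--supports stmt-QuantumFields-19200`, count-neutral.  YM₃ on T³ is a ladder
rung (R3), not the Clay problem; nothing here claims the stub `stub_existenceMinimalOrbit`, the row E′, the crux, d = 4 or the mass gap.

THE POINT (★p1 g14's «conserved-current shortcut», 2026-08-28 15:11Z).  The growth-side doors pair the first variation `Lin_W` with the true linearised average `Q^{(K−n)}_W(iD)` of a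
competitor direction only MODULO coarse pure gauges (✓ `Prop7LocMinOfGaugedRows`, ✓ `Prop7HcoWOfGaugedRows`), so the JOINT row is needed only for
`Q^{(K−n)}(iD) + P_{W̄}Λ_{K−n}` with `Λ` the coarse gauge function of record of the sourced log-ratio family; on the untwisted fibre (`(e^{iD}W)‾^{(K−n)} = W̄^{(K−n)}`) that is minus the
REDUCED sourced family `G_{K−n}`, whose `ℓ¹` norm is geometric from the top in the MASS channel alone (F2 ✓ `Prop7FibreLogRatioGaugedL1.sum_norm_trueLinIter_add_pureGauge_expChart_le_log`).
This file instantiates the tower: sources `r_l ≤ 694800L⁵·M_l` (F3 ✓ `Prop7LogRemainderMass.sum_norm_logRemainder_le_mass`), level masses `M_l ≤ 7M₀L^{−l} + (28800L⁴·KD + 600000L⁴ℓ⁻²M₀)Lˡ`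
(F4b ✓ `Prop7FibreLevelMassPerLevelT3.sum_normSq_levelRatio_le_LOnly_T3`), power counting (F4 ✓ `Prop7JointRowOfLevelMasses.jointRow_currency`, amplification `≤ 3∕2` by
✓ `Prop7JointRowTowerData.levelSizes_of_regPr`), the `𝔰𝔲(2)`-valuedness of `μ := −Λ_{K−n}` (F0 ✓ `Prop7TrueLinRealityFamilies.su_sourcedReduced ∕ su_coarseGauge` over
✓ `Prop7JointRowTowerData.suRows`), and the currency junction `(M₀, CURL + DIV of Y = e^{iD} − 1)` → `(Σ‖D‖², Σ_p‖ℒ_p(D)‖² + Σ‖D^*_W(iD)‖²_HS)` (§1: ✓ `Prop7RelPlaqVsCovCurl.sum_hs_curl_le_relPlaq_T3`,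
✓ `Prop7HessWOfFibreCoreT3Rows.sum_normSq_relPlaq_expChart_le ∕ sum_hs_divB_pertVar_le_of_budget ∕ normSq_pertVar_le_two_normSq_D`; the `s²M`-pieces join `C₁` since `ℓs ≤ 1`).

WHAT IS PROVED (ns `…Theorems.Prop7JointRowOfSuppliers`; T³, `SU(2)`).
* §1 `currency_junction` (`M₀ ≤ 2M`, `CURL + DIV ≤ 8(K + DIV₁₁₆) + (321072s² + 1536(eℓ⁻²)²)M`), and the scalar letters `bookkeeping`, `ell_mul_cs_le`, `sub_negGauge_eq`.
* §2 ★★★ `jointRow_of_suppliers` — per competitor datum (`W ∈ regFibrePr(e, V)`, `D` Hermitian traceless, `‖D(b)‖ ≤ s`, `e^{iD}W ∈ 𝔅_k(V)`, windows `10¹⁴L⁹e ≤ 1`,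
  `4·10¹¹L⁹(ℓs) ≤ 1`, `4s ≤ 1`; `Q` any recursion family of record): the JOINT conjunct of ✓ `Prop7LocMinOfGaugedRows116.isMinOn_regFibrePr_of_fibreRows_at` ∕ of
  ✓ `Prop7HcoWOfGaugedRows.hcoW_of_gaugedRowsW` LETTER FOR LETTER, with `C₂ = 8A₂`, `C₁ = 2A₁ + 322608A₂`, `A₁ = (3∕2)·694800L⁵·(7L²∕(L−1) + 600000L⁴·L²∕(L³−1))`,
  `A₂ = (3∕2)·694800L⁵·28800L⁴·L²∕(L³−1)` (L-only; k- and volume-independent).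
HONEST SCOPE.  A knit of landed theorems plus numerals: every analytic input is one of the cited tree theorems; the CHART row (the competitor's untwisted representative with
`‖D(b)‖ ≤ s₀ℓ⁻¹`) and the SLICE budget remain the displayed rows of the doors.  Nothing of [Balaban1985Variational] is asserted; E′ and EX are NOT closed by this file.

References: T. Bałaban, CMP 102 (1985) 277–309 [Balaban1985Variational] ((15) p.280, (47)–(48) pp.285–286, (80) p.290, (112) p.294, (116) p.295, (141)–(143) p.299);
CMP 98 (1985) 17–51 [Balaban1985Averaging] (Prop. 3 (122)–(126) p.36); CMP 95 (1984) 17–40 [Balaban1984PropagatorsI] ((1.18)–(1.20) pp.19–20); CMP 99 (1985) 389–434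
[Balaban1985BackgroundPropagators] ((3.3)–(3.4) pp.390–391, (3.8) p.392, Thm 3.11 p.416).
-/

set_option autoImplicit false

noncomputable section

open scoped BigOperators Matrix.Norms.L2Operator Matrix

namespace Summit.QuantumFields.YangMills.Theorems.Prop7JointRowOfSuppliers

open Literature.MathematicalPhysics.QuantumFieldTheory.Balaban1983to89
open Literature.MathematicalPhysics.QuantumFieldTheory.Balaban1983to89.T3ContinuumYM3Torus
open Literature.MathematicalPhysics.QuantumFieldTheory.Balaban1983to89.T3UnitLawDensityEML (ℰp)
open Literature.MathematicalPhysics.QuantumFieldTheory.Balaban1983to89.T3ConstrainedMinimiser (fibre)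
open Literature.MathematicalPhysics.QuantumFieldTheory.Balaban1983to89.T3RegularMinimiser (regThreshold)
open Literature.MathematicalPhysics.QuantumFieldTheory.Balaban1983to89.T3PrintedRegularMinimiser (RegPr regFibrePr mem_regFibrePr_iff)
open Literature.MathematicalPhysics.QuantumFieldTheory.Balaban1983to89.T3SectALandauChart (emb15 pos_of_regPr)
open Finset T4Continuum BlockAveraging AveragingRT ExpMeanLog BlockAveragingEMLLinearised BlockAveragingEMLLinearisedBackground BlockAveragingEMLProp2 B1RG242Torus
open MatrixLog (mlog)
open B9Eq39Adjoint (curl divB)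
open B10Eq27TorusAxialLog (unitsField toUField)
open B9TorusCalculus (torusT)
open Summit.QuantumFields.YangMills.Theorems.Prop7TPrint (expHermField)
open Summit.QuantumFields.YangMills.Theorems.Prop7CurvedLandauKnitT3 (three_le_L)
open Summit.QuantumFields.YangMills.Theorems.Prop7CurvedLandauRowA (exists_coarseGauge_family)
open Summit.QuantumFields.YangMills.Theorems.Prop7TrueLinSourcedStructure (exists_sourced_reduced_family)
open Summit.QuantumFields.YangMills.Theorems.Prop7HessWOfFibreCoreT3Rows (pertVar_expChart_eq normSq_pertVar_le_two_normSq_D norm_pertVar_expChart_le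
  sum_normSq_relPlaq_expChart_le sum_hs_divB_pertVar_le_of_budget)
open Summit.QuantumFields.YangMills.Theorems.Prop7RelPlaqVsCovCurl (sum_hs_curl_le_relPlaq_T3)
open Summit.QuantumFields.YangMills.Theorems.Prop7BlendClause1 (pertVar_eq_mul_star)
open Summit.QuantumFields.YangMills.Theorems.Prop7AxialLemma1 (iter_eq_of_mem_fibre)
open Summit.QuantumFields.YangMills.Theorems.Prop7JointRowTowerData

variable (F : T3Family) {n K : ℕ}

/-! ## §1 The currency junction at the chart point: `(M₀, CURL + DIV)` of `Y = e^{iD} − 1` against `(Σ‖D‖², Σ_p‖ℒ_p(D)‖² + DIV(iD))` -/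

set_option maxHeartbeats 400000 in
/-- **THE CURRENCY JUNCTION.**  `W` with `dist1(W(∂p)) ≤ e·ℓ⁻²`, `D` Hermitian traceless, `‖D(b)‖ ≤ s ≤ 1∕4`; `Y(b) = e^{iD(b)} − 1` the fluctuation of the chart point `W′ = e^{iD}W`
against `W` (✓ `pertVar_expChart_eq`).  Then `Σ_b‖Y(b)‖² ≤ 2Σ_b‖D(b)‖²` (✓ `normSq_pertVar_le_two_normSq_D`) and
`Σ‖curl_W Y‖²_HS + Σ‖D^*_W Y‖²_HS ≤ 8·(Σ_p‖ℒ_p(D)‖² + Σ‖D^*_W(iD)‖²_HS) + (321072s² + 1536(eℓ⁻²)²)·Σ_b‖D(b)‖²`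
(✓ `Prop7RelPlaqVsCovCurl.sum_hs_curl_le_relPlaq_T3` at `ρ = 2s` ∘ ✓ `sum_normSq_relPlaq_expChart_le`; ✓ `sum_hs_divB_pertVar_le_of_budget` at `δ = 0`, `Z = Σ‖D^*_W(iD)‖²_HS`).
[cite: Balaban1985Variational, (15) p.280, (22)-(28) pp.281-282, (116) p.295; Balaban1985BackgroundPropagators, (3.3)-(3.4) pp.390-391, (3.8) p.392] -/
theorem currency_junction {e s : ℝ} (hs4 : 4 * s ≤ 1)
    (W : GaugeField (F.P K) 0 (Matrix.specialUnitaryGroup (Fin 2) ℂ))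
    (hU : ∀ p : Plaq (F.P K) 0, dist1 (GaugeField.plaqHol W p) ≤ e * (((F.L : ℝ) ^ (K - n)) ^ 2)⁻¹)
    (D : PBond (F.P K) 0 → Matrix (Fin 2) (Fin 2) ℂ) (hD : ∀ b : PBond (F.P K) 0, (D b).IsHermitian ∧ Matrix.trace (D b) = 0)
    (hs : ∀ b : PBond (F.P K) 0, ‖D b‖ ≤ s) :
    (∑ b : PBond (F.P K) 0, ‖pertVar W (emb15 W (expHermField D)) b‖ ^ 2) ≤ 2 * (∑ b : PBond (F.P K) 0, ‖D b‖ ^ 2) ∧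
    ((∑ x : Site (F.P K) 0, ∑ μ : Fin (F.P K).d, ∑ ν : Fin (F.P K).d,
            (if μ < ν then ∑ j : Fin 2, ∑ k : Fin 2,
              ‖(curl (torusT (F.P K) 0) (fun κ z => unitsField (toUField W) ⟨z, κ⟩) (fun κ z => pertVar W (emb15 W (expHermField D)) ⟨z, κ⟩) μ ν x) j k‖ ^ 2 else 0)) + (∑ x : Site (F.P K) 0, ∑ j : Fin 2, ∑ k : Fin 2,
            ‖(divB (torusT (F.P K) 0) (fun κ z => unitsField (toUField W) ⟨z, κ⟩) (fun κ z => pertVar W (emb15 W (expHermField D)) ⟨z, κ⟩) x) j k‖ ^ 2))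
      ≤ 8 * ((∑ p : Plaq (F.P K) 0, ‖((Complex.I • D ⟨p.src, p.μ⟩) + ((W ⟨p.src, p.μ⟩ : Matrix (Fin 2) (Fin 2) ℂ) * (Complex.I • D ⟨p.src.shift p.μ, p.ν⟩) * star (W ⟨p.src, p.μ⟩ : Matrix (Fin 2) (Fin 2) ℂ))
            - (((W ⟨p.src, p.μ⟩ * W ⟨p.src.shift p.μ, p.ν⟩ * (W ⟨p.src.shift p.ν, p.μ⟩)⁻¹ : Matrix.specialUnitaryGroup (Fin 2) ℂ) : Matrix (Fin 2) (Fin 2) ℂ) * (Complex.I • D ⟨p.src.shift p.ν, p.μ⟩) * star ((W ⟨p.src, p.μ⟩ * W ⟨p.src.shift p.μ, p.ν⟩ * (W ⟨p.src.shift p.ν, p.μ⟩)⁻¹ : Matrix.specialUnitaryGroup (Fin 2) ℂ) : Matrix (Fin 2) (Fin 2) ℂ))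
            - (((GaugeField.plaqHol W p : Matrix.specialUnitaryGroup (Fin 2) ℂ) : Matrix (Fin 2) (Fin 2) ℂ) * (Complex.I • D ⟨p.src, p.ν⟩) * star ((GaugeField.plaqHol W p : Matrix.specialUnitaryGroup (Fin 2) ℂ) : Matrix (Fin 2) (Fin 2) ℂ)))‖ ^ 2)
              + (∑ x : Site (F.P K) 0, ∑ j : Fin 2, ∑ k : Fin 2,
            ‖(divB (torusT (F.P K) 0) (fun κ z => unitsField (toUField W) ⟨z, κ⟩) (fun κ z => Complex.I • D ⟨z, κ⟩) x) j k‖ ^ 2))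
        + (321072 * s ^ 2 + 1536 * (e * (((F.L : ℝ) ^ (K - n)) ^ 2)⁻¹) ^ 2) * (∑ b : PBond (F.P K) 0, ‖D b‖ ^ 2) := by
  have h4 : ∀ b : PBond (F.P K) 0, ‖D b‖ ≤ 1 / 4 := fun b => (hs b).trans (by linarith)
  have hM0 : (∑ b : PBond (F.P K) 0, ‖pertVar W (emb15 W (expHermField D)) b‖ ^ 2) ≤ 2 * (∑ b : PBond (F.P K) 0, ‖D b‖ ^ 2) := by
    rw [Finset.mul_sum]
    exact Finset.sum_le_sum fun b _ => normSq_pertVar_le_two_normSq_D W D b (hD b) (h4 b)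
  refine ⟨hM0, ?_⟩
  -- the sup of `Y` and the dictionary `Y(b) = W′(b)W(b)* − 1`
  have hYsup : ∀ b : PBond (F.P K) 0, ‖((emb15 W (expHermField D)) b : Matrix (Fin 2) (Fin 2) ℂ) * star (W b : Matrix (Fin 2) (Fin 2) ℂ) - 1‖ ≤ 2 * s := fun b => by
    rw [← pertVar_eq_mul_star]
    exact (norm_pertVar_expChart_le W D b (hD b) ((h4 b).trans (by norm_num))).trans (by linarith [hs b])
  have hfun : (fun (κ : Fin (F.P K).d) (z : Site (F.P K) 0) => pertVar W (emb15 W (expHermField D)) ⟨z, κ⟩)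
      = (fun (κ : Fin (F.P K).d) (z : Site (F.P K) 0) => ((emb15 W (expHermField D)) ⟨z, κ⟩ : Matrix (Fin 2) (Fin 2) ℂ) * star (W ⟨z, κ⟩ : Matrix (Fin 2) (Fin 2) ℂ) - 1) := by
    funext κ z; exact pertVar_eq_mul_star W (emb15 W (expHermField D)) ⟨z, κ⟩
  -- CURL
  have hcurl := sum_hs_curl_le_relPlaq_T3 F n K (emb15 W (expHermField D)) W hU hYsup (by linarith)
  rw [← hfun] at hcurl
  have hsumY : ∑ b : PBond (F.P K) 0, ‖((emb15 W (expHermField D)) b : Matrix (Fin 2) (Fin 2) ℂ) * star (W b : Matrix (Fin 2) (Fin 2) ℂ) - 1‖ ^ 2 = (∑ b : PBond (F.P K) 0, ‖pertVar W (emb15 W (expHermField D)) b‖ ^ 2) :=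
    Finset.sum_congr rfl fun b _ => by rw [← pertVar_eq_mul_star]
  rw [hsumY] at hcurl
  have hrel := sum_normSq_relPlaq_expChart_le W D hD hs hs4
  -- DIV
  have hdiv := sum_hs_divB_pertVar_le_of_budget W D hD hs (by linarith) (δ := 0)
    (Z := (∑ x : Site (F.P K) 0, ∑ j : Fin 2, ∑ k : Fin 2,
            ‖(divB (torusT (F.P K) 0) (fun κ z => unitsField (toUField W) ⟨z, κ⟩) (fun κ z => Complex.I • D ⟨z, κ⟩) x) j k‖ ^ 2))
    (by rw [zero_mul, zero_add])
  -- assemble (linear bookkeeping; every bracket is an atom)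
  have hc0 : 0 ≤ 24576 * (2 * s) ^ 2 + 768 * (e * (((F.L : ℝ) ^ (K - n)) ^ 2)⁻¹) ^ 2 := by positivity
  have hM0' := mul_le_mul_of_nonneg_left hM0 hc0
  have hDIV0 : 0 ≤ (∑ x : Site (F.P K) 0, ∑ j : Fin 2, ∑ k : Fin 2,
            ‖(divB (torusT (F.P K) 0) (fun κ z => unitsField (toUField W) ⟨z, κ⟩) (fun κ z => Complex.I • D ⟨z, κ⟩) x) j k‖ ^ 2) := by positivity
  have hK0 : 0 ≤ (∑ p : Plaq (F.P K) 0, ‖((Complex.I • D ⟨p.src, p.μ⟩) + ((W ⟨p.src, p.μ⟩ : Matrix (Fin 2) (Fin 2) ℂ) * (Complex.I • D ⟨p.src.shift p.μ, p.ν⟩) * star (W ⟨p.src, p.μ⟩ : Matrix (Fin 2) (Fin 2) ℂ))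
            - (((W ⟨p.src, p.μ⟩ * W ⟨p.src.shift p.μ, p.ν⟩ * (W ⟨p.src.shift p.ν, p.μ⟩)⁻¹ : Matrix.specialUnitaryGroup (Fin 2) ℂ) : Matrix (Fin 2) (Fin 2) ℂ) * (Complex.I • D ⟨p.src.shift p.ν, p.μ⟩) * star ((W ⟨p.src, p.μ⟩ * W ⟨p.src.shift p.μ, p.ν⟩ * (W ⟨p.src.shift p.ν, p.μ⟩)⁻¹ : Matrix.specialUnitaryGroup (Fin 2) ℂ) : Matrix (Fin 2) (Fin 2) ℂ))
            - (((GaugeField.plaqHol W p : Matrix.specialUnitaryGroup (Fin 2) ℂ) : Matrix (Fin 2) (Fin 2) ℂ) * (Complex.I • D ⟨p.src, p.ν⟩) * star ((GaugeField.plaqHol W p : Matrix.specialUnitaryGroup (Fin 2) ℂ) : Matrix (Fin 2) (Fin 2) ℂ)))‖ ^ 2) := by positivity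
  have hstep : (∑ x : Site (F.P K) 0, ∑ μ : Fin (F.P K).d, ∑ ν : Fin (F.P K).d,
            (if μ < ν then ∑ j : Fin 2, ∑ k : Fin 2,
              ‖(curl (torusT (F.P K) 0) (fun κ z => unitsField (toUField W) ⟨z, κ⟩) (fun κ z => pertVar W (emb15 W (expHermField D)) ⟨z, κ⟩) μ ν x) j k‖ ^ 2 else 0)) + (∑ x : Site (F.P K) 0, ∑ j : Fin 2, ∑ k : Fin 2,
            ‖(divB (torusT (F.P K) 0) (fun κ z => unitsField (toUField W) ⟨z, κ⟩) (fun κ z => pertVar W (emb15 W (expHermField D)) ⟨z, κ⟩) x) j k‖ ^ 2)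
      ≤ (4 * (2 * (∑ p : Plaq (F.P K) 0, ‖((Complex.I • D ⟨p.src, p.μ⟩) + ((W ⟨p.src, p.μ⟩ : Matrix (Fin 2) (Fin 2) ℂ) * (Complex.I • D ⟨p.src.shift p.μ, p.ν⟩) * star (W ⟨p.src, p.μ⟩ : Matrix (Fin 2) (Fin 2) ℂ))
            - (((W ⟨p.src, p.μ⟩ * W ⟨p.src.shift p.μ, p.ν⟩ * (W ⟨p.src.shift p.ν, p.μ⟩)⁻¹ : Matrix.specialUnitaryGroup (Fin 2) ℂ) : Matrix (Fin 2) (Fin 2) ℂ) * (Complex.I • D ⟨p.src.shift p.ν, p.μ⟩) * star ((W ⟨p.src, p.μ⟩ * W ⟨p.src.shift p.μ, p.ν⟩ * (W ⟨p.src.shift p.ν, p.μ⟩)⁻¹ : Matrix.specialUnitaryGroup (Fin 2) ℂ) : Matrix (Fin 2) (Fin 2) ℂ))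
            - (((GaugeField.plaqHol W p : Matrix.specialUnitaryGroup (Fin 2) ℂ) : Matrix (Fin 2) (Fin 2) ℂ) * (Complex.I • D ⟨p.src, p.ν⟩) * star ((GaugeField.plaqHol W p : Matrix.specialUnitaryGroup (Fin 2) ℂ) : Matrix (Fin 2) (Fin 2) ℂ)))‖ ^ 2) + 31104 * s ^ 2 * (∑ b : PBond (F.P K) 0, ‖D b‖ ^ 2)) + (24576 * (2 * s) ^ 2 + 768 * (e * (((F.L : ℝ) ^ (K - n)) ^ 2)⁻¹) ^ 2) * (2 * (∑ b : PBond (F.P K) 0, ‖D b‖ ^ 2)))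
        + ((2 * 0 + 48 * s ^ 2) * (∑ b : PBond (F.P K) 0, ‖D b‖ ^ 2) + 2 * (∑ x : Site (F.P K) 0, ∑ j : Fin 2, ∑ k : Fin 2,
            ‖(divB (torusT (F.P K) 0) (fun κ z => unitsField (toUField W) ⟨z, κ⟩) (fun κ z => Complex.I • D ⟨z, κ⟩) x) j k‖ ^ 2)) := by
    refine add_le_add (hcurl.trans ?_) hdiv
    have h4rel := mul_le_mul_of_nonneg_left hrel (by norm_num : (0:ℝ) ≤ 4)
    linarith
  refine hstep.trans ?_
  have hid : (4 * (2 * (∑ p : Plaq (F.P K) 0, ‖((Complex.I • D ⟨p.src, p.μ⟩) + ((W ⟨p.src, p.μ⟩ : Matrix (Fin 2) (Fin 2) ℂ) * (Complex.I • D ⟨p.src.shift p.μ, p.ν⟩) * star (W ⟨p.src, p.μ⟩ : Matrix (Fin 2) (Fin 2) ℂ))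
            - (((W ⟨p.src, p.μ⟩ * W ⟨p.src.shift p.μ, p.ν⟩ * (W ⟨p.src.shift p.ν, p.μ⟩)⁻¹ : Matrix.specialUnitaryGroup (Fin 2) ℂ) : Matrix (Fin 2) (Fin 2) ℂ) * (Complex.I • D ⟨p.src.shift p.ν, p.μ⟩) * star ((W ⟨p.src, p.μ⟩ * W ⟨p.src.shift p.μ, p.ν⟩ * (W ⟨p.src.shift p.ν, p.μ⟩)⁻¹ : Matrix.specialUnitaryGroup (Fin 2) ℂ) : Matrix (Fin 2) (Fin 2) ℂ))
            - (((GaugeField.plaqHol W p : Matrix.specialUnitaryGroup (Fin 2) ℂ) : Matrix (Fin 2) (Fin 2) ℂ) * (Complex.I • D ⟨p.src, p.ν⟩) * star ((GaugeField.plaqHol W p : Matrix.specialUnitaryGroup (Fin 2) ℂ) : Matrix (Fin 2) (Fin 2) ℂ)))‖ ^ 2) + 31104 * s ^ 2 * (∑ b : PBond (F.P K) 0, ‖D b‖ ^ 2)) + (24576 * (2 * s) ^ 2 + 768 * (e * (((F.L : ℝ) ^ (K - n)) ^ 2)⁻¹) ^ 2) * (2 * (∑ b : PBond (F.P K) 0,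 ‖D b‖ ^ 2)))
        + ((2 * 0 + 48 * s ^ 2) * (∑ b : PBond (F.P K) 0, ‖D b‖ ^ 2) + 2 * (∑ x : Site (F.P K) 0, ∑ j : Fin 2, ∑ k : Fin 2,
            ‖(divB (torusT (F.P K) 0) (fun κ z => unitsField (toUField W) ⟨z, κ⟩) (fun κ z => Complex.I • D ⟨z, κ⟩) x) j k‖ ^ 2))
      = 8 * (∑ p : Plaq (F.P K) 0, ‖((Complex.I • D ⟨p.src, p.μ⟩) + ((W ⟨p.src, p.μ⟩ : Matrix (Fin 2) (Fin 2) ℂ) * (Complex.I • D ⟨p.src.shift p.μ, p.ν⟩) * star (W ⟨p.src, p.μ⟩ : Matrix (Fin 2) (Fin 2) ℂ))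
            - (((W ⟨p.src, p.μ⟩ * W ⟨p.src.shift p.μ, p.ν⟩ * (W ⟨p.src.shift p.ν, p.μ⟩)⁻¹ : Matrix.specialUnitaryGroup (Fin 2) ℂ) : Matrix (Fin 2) (Fin 2) ℂ) * (Complex.I • D ⟨p.src.shift p.ν, p.μ⟩) * star ((W ⟨p.src, p.μ⟩ * W ⟨p.src.shift p.μ, p.ν⟩ * (W ⟨p.src.shift p.ν, p.μ⟩)⁻¹ : Matrix.specialUnitaryGroup (Fin 2) ℂ) : Matrix (Fin 2) (Fin 2) ℂ))
            - (((GaugeField.plaqHol W p : Matrix.specialUnitaryGroup (Fin 2) ℂ) : Matrix (Fin 2) (Fin 2) ℂ) * (Complex.I • D ⟨p.src, p.ν⟩) * star ((GaugeField.plaqHol W p : Matrix.specialUnitaryGroup (Fin 2) ℂ) : Matrix (Fin 2) (Fin 2) ℂ)))‖ ^ 2) + 2 * (∑ x : Site (F.P K) 0, ∑ j : Fin 2, ∑ k : Fin 2,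
            ‖(divB (torusT (F.P K) 0) (fun κ z => unitsField (toUField W) ⟨z, κ⟩) (fun κ z => Complex.I • D ⟨z, κ⟩) x) j k‖ ^ 2) + (321072 * s ^ 2 + 1536 * (e * (((F.L : ℝ) ^ (K - n)) ^ 2)⁻¹) ^ 2) * (∑ b : PBond (F.P K) 0, ‖D b‖ ^ 2) := by ring
  rw [hid]
  nlinarith [hDIV0, hK0]

/-- The final real bookkeeping of §2 (pure arithmetic, every bracket an atom): from `X ≤ A₁·(ℓ⁻¹M₀) + A₂·(ℓ·KD)`, `M₀ ≤ 2M`, `KD ≤ 8(K + DIV) + c·M` and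
`ℓ·c ≤ 322608·ℓ⁻¹` conclude `X ≤ (2A₁ + 322608A₂)·ℓ⁻¹·M + 8A₂·ℓ·(K + DIV)`. [folklore] -/
theorem bookkeeping {A₁ A₂ ℓ M₀ M KD Kc DIV c X : ℝ} (hA₁ : 0 ≤ A₁) (hA₂ : 0 ≤ A₂) (hℓ : 0 < ℓ) (hM : 0 ≤ M)
    (hM₀ : M₀ ≤ 2 * M) (hKD : KD ≤ 8 * (Kc + DIV) + c * M) (hc : ℓ * c ≤ 322608 * ℓ⁻¹)
    (hX : X ≤ A₁ * (ℓ⁻¹ * M₀) + A₂ * (ℓ * KD)) :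
    X ≤ (2 * A₁ + 322608 * A₂) * ℓ⁻¹ * M + (8 * A₂) * ℓ * (Kc + DIV) := by
  have h1 : A₁ * (ℓ⁻¹ * M₀) ≤ A₁ * (ℓ⁻¹ * (2 * M)) :=
    mul_le_mul_of_nonneg_left (mul_le_mul_of_nonneg_left hM₀ (inv_nonneg.mpr hℓ.le)) hA₁
  have h2 : A₂ * (ℓ * KD) ≤ A₂ * (ℓ * (8 * (Kc + DIV) + c * M)) :=
    mul_le_mul_of_nonneg_left (mul_le_mul_of_nonneg_left hKD hℓ.le) hA₂
  have h3 : A₂ * ((ℓ * c) * M) ≤ A₂ * ((322608 * ℓ⁻¹) * M) :=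
    mul_le_mul_of_nonneg_left (mul_le_mul_of_nonneg_right hc hM) hA₂
  have e2 : A₂ * (ℓ * (8 * (Kc + DIV) + c * M)) = (8 * A₂) * ℓ * (Kc + DIV) + A₂ * ((ℓ * c) * M) := by ring
  have e3 : A₂ * ((322608 * ℓ⁻¹) * M) = (322608 * A₂) * ℓ⁻¹ * M := by ring
  have e1 : A₁ * (ℓ⁻¹ * (2 * M)) = (2 * A₁) * ℓ⁻¹ * M := by ring
  linarith

/-- `ℓ·(321072s² + 1536(e·(ℓ²)⁻¹)²) ≤ 322608·ℓ⁻¹` once `ℓs ≤ 1`, `0 ≤ e ≤ 1 ≤ ℓ` (the `s²M` pieces of the K′→K junction join `C₁`). [folklore] -/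
theorem ell_mul_cs_le {ℓ s e : ℝ} (hℓ : 1 ≤ ℓ) (hs0 : 0 ≤ s) (hℓs : ℓ * s ≤ 1) (he0 : 0 ≤ e) (he1 : e ≤ 1) :
    ℓ * (321072 * s ^ 2 + 1536 * (e * (ℓ ^ 2)⁻¹) ^ 2) ≤ 322608 * ℓ⁻¹ := by
  have hℓpos : 0 < ℓ := by linarith
  have hsq : ℓ ^ 2 * (321072 * s ^ 2 + 1536 * (e * (ℓ ^ 2)⁻¹) ^ 2) ≤ 322608 := by
    have e1 : ℓ ^ 2 * (321072 * s ^ 2 + 1536 * (e * (ℓ ^ 2)⁻¹) ^ 2) = 321072 * (ℓ * s) ^ 2 + 1536 * (e ^ 2 * (ℓ ^ 2)⁻¹) := by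
      field_simp
    rw [e1]
    have h1 : (ℓ * s) ^ 2 ≤ 1 := pow_le_one₀ (by positivity) hℓs
    have he2 : e ^ 2 ≤ 1 := pow_le_one₀ he0 he1
    have hi : (ℓ ^ 2)⁻¹ ≤ 1 := inv_le_one_of_one_le₀ (one_le_pow₀ hℓ)
    have h2 : e ^ 2 * (ℓ ^ 2)⁻¹ ≤ 1 := by nlinarith [inv_nonneg.mpr (sq_nonneg ℓ), sq_nonneg e]
    linarith
  have e2 : ℓ * (321072 * s ^ 2 + 1536 * (e * (ℓ ^ 2)⁻¹) ^ 2) = ℓ⁻¹ * (ℓ ^ 2 * (321072 * s ^ 2 + 1536 * (e * (ℓ ^ 2)⁻¹) ^ 2)) := by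
    field_simp
  rw [e2]
  nlinarith [inv_pos.mpr hℓpos]

/-- The sign flip of the coarse gauge term: `X − ((−a) − V·(−t)·V⋆) = X + (a − V·t·V⋆)`. [folklore] -/
theorem sub_negGauge_eq {R : Type*} [Ring R] (X a t V Vs : R) : X - (-a - V * -t * Vs) = X + (a - V * t * Vs) := by
  noncomm_ring

/-! ## §2 ★★★ The JOINT remainder row modulo coarse pure gauges, from the suppliers -/

set_option maxHeartbeats 400000 in
/-- ★★★ **F5 — THE JOINT ROW MOD COARSE GAUGE OF ✓ `Prop7LocMinOfGaugedRows116.isMinOn_regFibrePr_of_fibreRows_at` ∕ ✓ `Prop7HcoWOfGaugedRows.hcoW_of_gaugedRowsW`,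
DISCHARGED AT AN UNTWISTED CHART POINT.**  Datum: `W ∈ (6)(e) ∩ 𝔅_k(V)` (`regFibrePr`), windows `10¹⁴L⁹e ≤ 1`, `4·10¹¹L⁹(ℓs) ≤ 1`, `4s ≤ 1`; `D` Hermitian traceless with
`‖D(b)‖ ≤ s` and the chart point `e^{iD}W ∈ 𝔅_k(V)` (UNTWISTED); `Q` any recursion family of the true one-step linearisations along `W`'s tower.  CONCLUSION (letter for
letter the JOINT conjunct of the (116)+fibre door): an `𝔰𝔲(2)`-valued coarse site field `μ` (:= `−Λ_{K−n}`, the coarse gauge function of record of the sourced log-ratio family)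
with `Σ_c‖(Q (K−n) (iD))(c) − (μ(c₋) − W̄(c)μ(c₊)W̄(c)*)‖ ≤ C₁·ℓ⁻¹·Σ_b‖D(b)‖² + C₂·ℓ·(Σ_p‖ℒ_p(D)‖² + Σ_x‖D^*_W(iD)(x)‖²_HS)`, `ℓ = L^{K−n}`, with the L-ONLY constants
`C₂ = 8A₂`, `C₁ = 2A₁ + 322608A₂`, `A₁ = (3∕2)·694800L⁵·(7L²∕(L−1) + 600000L⁴·L²∕(L³−1))`, `A₂ = (3∕2)·694800L⁵·28800L⁴·L²∕(L³−1)`.  PROOF = ✓ F2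
`Prop7FibreLogRatioGaugedL1.sum_norm_trueLinIter_add_pureGauge_expChart_le_log` (G-channel only, amplification `≤ 3∕2` by `levelSizes_of_regPr`) + ✓ F3
`Prop7LogRemainderMass.sum_norm_logRemainder_le_mass` per level (guards `chartSups` ∕ `supNumerals`) + ✓ F4b `Prop7FibreLevelMassPerLevelT3.sum_normSq_levelRatio_le_LOnly_T3` +
✓ F4 `Prop7JointRowOfLevelMasses.jointRow_currency` + ✓ F0 (`su_sourcedReduced`, `su_coarseGauge`, inputs `suRows`) + §1.
[cite: Balaban1985Variational, (47)-(48) pp.285-286, (80) p.290, (112) p.294, (116) p.295, (141)-(143) p.299; Balaban1985Averaging, Prop. 3 (122)-(126) p.36; Balaban1984PropagatorsI, (1.18)-(1.20) pp.19-20; Balaban1985BackgroundPropagators, Thm 3.11 p.416] -/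
theorem jointRow_of_suppliers (h : n ≤ K) {e s : ℝ} (he : 0 < e) (heL : 100000000000000 * (F.L : ℝ) ^ 9 * e ≤ 1)
    (hs0 : 0 ≤ s) (hs4 : 4 * s ≤ 1) (hsL : 400000000000 * (F.L : ℝ) ^ 9 * (((F.L : ℝ) ^ (K - n)) * s) ≤ 1)
    (V : GaugeField (F.P n) 0 (Matrix.specialUnitaryGroup (Fin 2) ℂ)) {W : GaugeField (F.P K) 0 (Matrix.specialUnitaryGroup (Fin 2) ℂ)}
    (hWe : W ∈ regFibrePr F n K h e V)
    (Q : (k : ℕ) → (PBond (F.P K) 0 → Matrix (Fin 2) (Fin 2) ℂ) → PBond (F.P K) k → Matrix (Fin 2) (Fin 2) ℂ) (hQ0 : ∀ Y, Q 0 Y = Y)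
    (hQs : ∀ (k : ℕ) (Y : PBond (F.P K) 0 → Matrix (Fin 2) (Fin 2) ℂ) (c : PBond (F.P K) (k + 1)), Q (k + 1) Y c
      = fderiv ℂ (eml : (Idx (F.P K) → Matrix (Fin 2) (Fin 2) ℂ) → Matrix (Fin 2) (Fin 2) ℂ)
            (fun i => ((loopHol (Averaging.iter (fun i => blockAvg (P := F.P K) (j := i) (expMeanLogSU (n := Fin 2))) k W) c i :
              Matrix.specialUnitaryGroup (Fin 2) ℂ) : Matrix (Fin 2) (Fin 2) ℂ))
            (fun i => covWalkSum (Averaging.iter (fun i => blockAvg (P := F.P K) (j := i) (expMeanLogSU (n := Fin 2))) k W) (Q k Y)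
                (walk (emb c.src) (loopWord (F.P K).L c.dir (off i.1) i.2.1 i.2.2))
              * ((loopHol (Averaging.iter (fun i => blockAvg (P := F.P K) (j := i) (expMeanLogSU (n := Fin 2))) k W) c i :
                Matrix.specialUnitaryGroup (Fin 2) ℂ) : Matrix (Fin 2) (Fin 2) ℂ))
            * star ((corr (expMeanLogSU (n := Fin 2)) (Averaging.iter (fun i => blockAvg (P := F.P K) (j := i) (expMeanLogSU (n := Fin 2))) k W) c :
                Matrix.specialUnitaryGroup (Fin 2) ℂ) : Matrix (Fin 2) (Fin 2) ℂ)
          + ((corr (expMeanLogSU (n := Fin 2)) (Averaging.iter (fun i => blockAvg (P := F.P K) (j := i) (expMeanLogSU (n := Fin 2))) k W) c :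
                Matrix.specialUnitaryGroup (Fin 2) ℂ) : Matrix (Fin 2) (Fin 2) ℂ)
            * covWalkSum (Averaging.iter (fun i => blockAvg (P := F.P K) (j := i) (expMeanLogSU (n := Fin 2))) k W) (Q k Y)
                (walk (emb c.src) (List.replicate (F.P K).L (c.dir, true)))
            * star ((corr (expMeanLogSU (n := Fin 2)) (Averaging.iter (fun i => blockAvg (P := F.P K) (j := i) (expMeanLogSU (n := Fin 2))) k W) c :
                Matrix.specialUnitaryGroup (Fin 2) ℂ) : Matrix (Fin 2) (Fin 2) ℂ))
    (D : PBond (F.P K) 0 → Matrix (Fin 2) (Fin 2) ℂ) (hD : ∀ b : PBond (F.P K) 0, (D b).IsHermitian ∧ Matrix.trace (D b) = 0)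
    (hs : ∀ b : PBond (F.P K) 0, ‖D b‖ ≤ s) (hW' : (emb15 W (expHermField D)) ∈ fibre F ℰp n K h V) :
    ∃ μ : Site (F.P K) (K - n) → Matrix (Fin 2) (Fin 2) ℂ, (∀ y, μ y ∈ skewAdjoint (Matrix (Fin 2) (Fin 2) ℂ) ∧ (μ y).trace = 0) ∧
          ∑ c : PBond (F.P K) (K - n), ‖Q (K - n) (fun b => Complex.I • D b) c
              - (μ c.src
                - ((Averaging.iter (fun i => blockAvg (P := F.P K) (j := i) (expMeanLogSU (n := Fin 2))) (K - n) W c : Matrix.specialUnitaryGroup (Fin 2) ℂ) :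
                    Matrix (Fin 2) (Fin 2) ℂ) * μ c.tgt
                  * star ((Averaging.iter (fun i => blockAvg (P := F.P K) (j := i) (expMeanLogSU (n := Fin 2))) (K - n) W c : Matrix.specialUnitaryGroup (Fin 2) ℂ) :
                    Matrix (Fin 2) (Fin 2) ℂ))‖
            ≤ (2 * ((3 / 2) * (694800 * (F.L : ℝ) ^ 5) * (7 * ((F.L : ℝ) ^ 2 / ((F.L : ℝ) - 1)) + 600000 * (F.L : ℝ) ^ 4 * ((F.L : ℝ) ^ 2 / ((F.L : ℝ) ^ 3 - 1)))) + 322608 * ((3 / 2) * (694800 * (F.L : ℝ) ^ 5) * (28800 * (F.L : ℝ) ^ 4) * ((F.L : ℝ) ^ 2 / ((F.L : ℝ) ^ 3 - 1)))) * ((F.L : ℝ) ^ (K - n))⁻¹ * (∑ b : PBond (F.P K) 0, ‖D b‖ ^ 2)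
              + (8 * ((3 / 2) * (694800 * (F.L : ℝ) ^ 5) * (28800 * (F.L : ℝ) ^ 4) * ((F.L : ℝ) ^ 2 / ((F.L : ℝ) ^ 3 - 1)))) * (F.L : ℝ) ^ (K - n) * ((∑ p : Plaq (F.P K) 0, ‖((Complex.I • D ⟨p.src, p.μ⟩) + ((W ⟨p.src, p.μ⟩ : Matrix (Fin 2) (Fin 2) ℂ) * (Complex.I • D ⟨p.src.shift p.μ, p.ν⟩) * star (W ⟨p.src, p.μ⟩ : Matrix (Fin 2) (Fin 2) ℂ))
            - (((W ⟨p.src, p.μ⟩ * W ⟨p.src.shift p.μ, p.ν⟩ * (W ⟨p.src.shift p.ν, p.μ⟩)⁻¹ : Matrix.specialUnitaryGroup (Fin 2) ℂ) : Matrix (Fin 2) (Fin 2) ℂ) * (Complex.I • D ⟨p.src.shift p.ν, p.μ⟩) * star ((W ⟨p.src, p.μ⟩ * W ⟨p.src.shift p.μ, p.ν⟩ * (W ⟨p.src.shift p.ν, p.μ⟩)⁻¹ : Matrix.specialUnitaryGroup (Fin 2) ℂ) : Matrix (Fin 2) (Fin 2) ℂ))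
            - (((GaugeField.plaqHol W p : Matrix.specialUnitaryGroup (Fin 2) ℂ) : Matrix (Fin 2) (Fin 2) ℂ) * (Complex.I • D ⟨p.src, p.ν⟩) * star ((GaugeField.plaqHol W p : Matrix.specialUnitaryGroup (Fin 2) ℂ) : Matrix (Fin 2) (Fin 2) ℂ)))‖ ^ 2)
                + (∑ x : Site (F.P K) 0, ∑ j : Fin 2, ∑ k : Fin 2,
            ‖(divB (torusT (F.P K) 0) (fun κ z => unitsField (toUField W) ⟨z, κ⟩) (fun κ z => Complex.I • D ⟨z, κ⟩) x) j k‖ ^ 2)) := by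
  -- letters and windows
  have hL3 : (3 : ℝ) ≤ (F.L : ℝ) := three_le_L F
  have hPL : ((F.P K).L : ℝ) = F.L := rfl
  have hd : (F.P K).d = 3 := T3Family.P_d F K
  have hL0 : (0 : ℝ) < (F.L : ℝ) := by linarith
  have hL1 : (1 : ℝ) ≤ (F.L : ℝ) := by linarith
  have hL2 : (2 : ℝ) ≤ (F.L : ℝ) := by linarith
  have hm := F.hm
  obtain ⟨hWfib, hreg⟩ := (mem_regFibrePr_iff F).mp hWe
  have heL' : 1000000 * (F.L : ℝ) ^ 5 * e ≤ 1 := by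
    have h59 : (F.L : ℝ) ^ 5 ≤ (F.L : ℝ) ^ 9 := pow_le_pow_right₀ hL1 (by norm_num)
    nlinarith [pow_nonneg hL0.le 5, he.le]
  have he1 : e ≤ 1 := by
    have h9 : (1 : ℝ) ≤ (F.L : ℝ) ^ 9 := one_le_pow₀ hL1
    nlinarith [he.le]
  have hℓpos : 0 < ((F.L : ℝ) ^ (K - n)) := by positivity
  have hℓ1 : (1 : ℝ) ≤ ((F.L : ℝ) ^ (K - n)) := one_le_pow₀ hL1
  have hℓs1 : ((F.L : ℝ) ^ (K - n)) * s ≤ 1 := by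
    have h9 : (1 : ℝ) ≤ (F.L : ℝ) ^ 9 := one_le_pow₀ hL1
    have h0 : 0 ≤ ((F.L : ℝ) ^ (K - n)) * s := by positivity
    nlinarith
  have hk : K - n ≤ (F.P K).m + (F.P K).K := by show K - n ≤ F.m + K; omega
  have hfib : Averaging.iter (fun i => blockAvg (P := F.P K) (j := i) (expMeanLogSU (n := Fin 2))) (K - n) (emb15 W (expHermField D)) = Averaging.iter (fun i => blockAvg (P := F.P K) (j := i) (expMeanLogSU (n := Fin 2))) (K - n) W := iter_eq_of_mem_fibre F h hW' hWfib
  have hUe : ∀ p : Plaq (F.P K) 0, dist1 (GaugeField.plaqHol W p) ≤ e * ((((F.L : ℝ) ^ (K - n))) ^ 2)⁻¹ := by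
    intro p
    have h1 := (hreg.plaqSmall p).le
    have h2 : regThreshold F n K e = e * ((((F.L : ℝ) ^ (K - n))) ^ 2)⁻¹ := by
      rw [regThreshold, inv_pow, ← pow_mul, mul_comm 2 (K - n), pow_mul]
    rwa [h2] at h1
  have hDlog : ∀ b : PBond (F.P K) 0, ‖D b‖ < Real.log 2 := fun b =>
    (hs b).trans_lt (by have := Real.log_two_gt_d9; linarith)
  -- tower data (F5a)
  obtain ⟨hα, ha0, ha24, haN, hE⟩ := levelSizes_of_regPr F n K he heL' hreg
  obtain ⟨hsup, hμ⟩ := chartSups F n K he heL hs0 hs4 hsL hreg D hD hs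
  obtain ⟨hδj, hμ0, hμ72, hμN, hμθ, hθ0, hθL⟩ := supNumerals F n K hs0 hsL
  obtain ⟨hX, hR, hD₀⟩ := suRows F n K he heL hs0 hs4 hsL hreg D hD hs
  set a : ℕ → ℝ := (fun j : ℕ => ((((F.P K).d + 2) * (F.P K).L : ℕ) : ℝ) ^ 2 / 2 * e * ((((F.P K).L : ℝ)) ^ (2 * j) / (((F.P K).L : ℝ)) ^ (2 * (K - n)))) with ha_def
  -- the families of record (zero content) and their 𝔰𝔲(2) rows (F0)
  obtain ⟨G, hG0, hGs⟩ := exists_sourced_reduced_family W (fun b => mlog (pertVar W (emb15 W (expHermField D)) b + 1) - Complex.I • D b)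
    (fun j c => ((fun b => mlog (pertVar (Averaging.iter (fun i => blockAvg (P := F.P K) (j := i) (expMeanLogSU (n := Fin 2))) (j + 1) W) (Averaging.iter (fun i => blockAvg (P := F.P K) (j := i) (expMeanLogSU (n := Fin 2))) (j + 1) (emb15 W (expHermField D))) b + 1)) c - (fderiv ℂ (eml : (Idx (F.P K) → Matrix (Fin 2) (Fin 2) ℂ) → Matrix (Fin 2) (Fin 2) ℂ)
            (fun i => ((loopHol (Averaging.iter (fun i => blockAvg (P := F.P K) (j := i) (expMeanLogSU (n := Fin 2))) j W) c i : Matrix.specialUnitaryGroup (Fin 2) ℂ) : Matrix (Fin 2) (Fin 2) ℂ))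
            (fun i => covWalkSum (Averaging.iter (fun i => blockAvg (P := F.P K) (j := i) (expMeanLogSU (n := Fin 2))) j W) (fun b => mlog (pertVar (Averaging.iter (fun i => blockAvg (P := F.P K) (j := i) (expMeanLogSU (n := Fin 2))) j W) (Averaging.iter (fun i => blockAvg (P := F.P K) (j := i) (expMeanLogSU (n := Fin 2))) j (emb15 W (expHermField D))) b + 1)) (walk (emb c.src) (loopWord (F.P K).L c.dir (off i.1) i.2.1 i.2.2))
              * ((loopHol (Averaging.iter (fun i => blockAvg (P := F.P K) (j := i) (expMeanLogSU (n := Fin 2))) j W) c i : Matrix.specialUnitaryGroup (Fin 2) ℂ) : Matrix (Fin 2) (Fin 2) ℂ))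
            * star ((corr (expMeanLogSU (n := Fin 2)) (Averaging.iter (fun i => blockAvg (P := F.P K) (j := i) (expMeanLogSU (n := Fin 2))) j W) c : Matrix.specialUnitaryGroup (Fin 2) ℂ) : Matrix (Fin 2) (Fin 2) ℂ)
          + ((corr (expMeanLogSU (n := Fin 2)) (Averaging.iter (fun i => blockAvg (P := F.P K) (j := i) (expMeanLogSU (n := Fin 2))) j W) c : Matrix.specialUnitaryGroup (Fin 2) ℂ) : Matrix (Fin 2) (Fin 2) ℂ)
            * covWalkSum (Averaging.iter (fun i => blockAvg (P := F.P K) (j := i) (expMeanLogSU (n := Fin 2))) j W) (fun b => mlog (pertVar (Averaging.iter (fun i => blockAvg (P := F.P K) (j := i) (expMeanLogSU (n := Fin 2))) j W) (Averaging.iter (fun i => blockAvg (P := F.P K) (j := i) (expMeanLogSU (n := Fin 2))) j (emb15 W (expHermField D))) b + 1)) (walk (emb c.src) (List.replicate (F.P K).L (c.dir, true)))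
            * star ((corr (expMeanLogSU (n := Fin 2)) (Averaging.iter (fun i => blockAvg (P := F.P K) (j := i) (expMeanLogSU (n := Fin 2))) j W) c : Matrix.specialUnitaryGroup (Fin 2) ℂ) : Matrix (Fin 2) (Fin 2) ℂ))))
  obtain ⟨Λ, hΛ0, hΛs⟩ := exists_coarseGauge_family (N := 2) W G
  have hGsu := Prop7TrueLinRealityFamilies.su_sourcedReduced W (D₀ := fun b => mlog (pertVar W (emb15 W (expHermField D)) b + 1) - Complex.I • D b) hD₀
    (fun j c => ((fun b => mlog (pertVar (Averaging.iter (fun i => blockAvg (P := F.P K) (j := i) (expMeanLogSU (n := Fin 2))) (j + 1) W) (Averaging.iter (fun i => blockAvg (P := F.P K) (j := i) (expMeanLogSU (n := Fin 2))) (j + 1) (emb15 W (expHermField D))) b + 1)) c - (fderiv ℂ (eml : (Idx (F.P K) → Matrix (Fin 2) (Fin 2) ℂ) → Matrix (Fin 2) (Fin 2) ℂ)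
            (fun i => ((loopHol (Averaging.iter (fun i => blockAvg (P := F.P K) (j := i) (expMeanLogSU (n := Fin 2))) j W) c i : Matrix.specialUnitaryGroup (Fin 2) ℂ) : Matrix (Fin 2) (Fin 2) ℂ))
            (fun i => covWalkSum (Averaging.iter (fun i => blockAvg (P := F.P K) (j := i) (expMeanLogSU (n := Fin 2))) j W) (fun b => mlog (pertVar (Averaging.iter (fun i => blockAvg (P := F.P K) (j := i) (expMeanLogSU (n := Fin 2))) j W) (Averaging.iter (fun i => blockAvg (P := F.P K) (j := i) (expMeanLogSU (n := Fin 2))) j (emb15 W (expHermField D))) b + 1)) (walk (emb c.src) (loopWord (F.P K).L c.dir (off i.1) i.2.1 i.2.2))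
              * ((loopHol (Averaging.iter (fun i => blockAvg (P := F.P K) (j := i) (expMeanLogSU (n := Fin 2))) j W) c i : Matrix.specialUnitaryGroup (Fin 2) ℂ) : Matrix (Fin 2) (Fin 2) ℂ))
            * star ((corr (expMeanLogSU (n := Fin 2)) (Averaging.iter (fun i => blockAvg (P := F.P K) (j := i) (expMeanLogSU (n := Fin 2))) j W) c : Matrix.specialUnitaryGroup (Fin 2) ℂ) : Matrix (Fin 2) (Fin 2) ℂ)
          + ((corr (expMeanLogSU (n := Fin 2)) (Averaging.iter (fun i => blockAvg (P := F.P K) (j := i) (expMeanLogSU (n := Fin 2))) j W) c : Matrix.specialUnitaryGroup (Fin 2) ℂ) : Matrix (Fin 2) (Fin 2) ℂ)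
            * covWalkSum (Averaging.iter (fun i => blockAvg (P := F.P K) (j := i) (expMeanLogSU (n := Fin 2))) j W) (fun b => mlog (pertVar (Averaging.iter (fun i => blockAvg (P := F.P K) (j := i) (expMeanLogSU (n := Fin 2))) j W) (Averaging.iter (fun i => blockAvg (P := F.P K) (j := i) (expMeanLogSU (n := Fin 2))) j (emb15 W (expHermField D))) b + 1)) (walk (emb c.src) (List.replicate (F.P K).L (c.dir, true)))
            * star ((corr (expMeanLogSU (n := Fin 2)) (Averaging.iter (fun i => blockAvg (P := F.P K) (j := i) (expMeanLogSU (n := Fin 2))) j W) c : Matrix.specialUnitaryGroup (Fin 2) ℂ) : Matrix (Fin 2) (Fin 2) ℂ))))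
    G hG0 hGs (k := K - n) a hα haN hR
  have hΛsu := Prop7TrueLinRealityFamilies.su_coarseGauge W G Λ hΛ0 hΛs (k := K - n) (fun j hj c => hGsu j hj.le c)
  -- F2 §2: the gauged row against the damped ℓ¹ sources, amplification ≤ 3/2
  have hJ := Prop7FibreLogRatioGaugedL1.sum_norm_trueLinIter_add_pureGauge_expChart_le_log W D Q G hG0 hGs Λ hΛ0 hΛs hD hDlog hk hfib hQ0 hQs
    a ha0 hα ha24 haN
  have hJ2 := hJ.trans (mul_le_mul_of_nonneg_right hE (Finset.sum_nonneg fun l _ => by positivity))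
  have hρ1 : ((((F.P K).L : ℝ) ^ (F.P K).d)⁻¹ * ((F.P K).L : ℝ)) = ((F.L : ℝ) ^ 2)⁻¹ := by
    rw [hd, hPL]; field_simp
  rw [hρ1] at hJ2
  -- F3 per level, F4b level masses, F4 power counting
  set r : ℕ → ℝ := fun l => ∑ c : PBond (F.P K) (l + 1), ‖((fun b => mlog (pertVar (Averaging.iter (fun i => blockAvg (P := F.P K) (j := i) (expMeanLogSU (n := Fin 2))) (l + 1) W) (Averaging.iter (fun i => blockAvg (P := F.P K) (j := i) (expMeanLogSU (n := Fin 2))) (l + 1) (emb15 W (expHermField D))) b + 1)) c - (fderiv ℂ (eml : (Idx (F.P K) → Matrix (Fin 2) (Fin 2) ℂ) → Matrix (Fin 2) (Fin 2) ℂ)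
            (fun i => ((loopHol (Averaging.iter (fun i => blockAvg (P := F.P K) (j := i) (expMeanLogSU (n := Fin 2))) l W) c i : Matrix.specialUnitaryGroup (Fin 2) ℂ) : Matrix (Fin 2) (Fin 2) ℂ))
            (fun i => covWalkSum (Averaging.iter (fun i => blockAvg (P := F.P K) (j := i) (expMeanLogSU (n := Fin 2))) l W) (fun b => mlog (pertVar (Averaging.iter (fun i => blockAvg (P := F.P K) (j := i) (expMeanLogSU (n := Fin 2))) l W) (Averaging.iter (fun i => blockAvg (P := F.P K) (j := i) (expMeanLogSU (n := Fin 2))) l (emb15 W (expHermField D))) b + 1)) (walk (emb c.src) (loopWord (F.P K).L c.dir (off i.1) i.2.1 i.2.2))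
              * ((loopHol (Averaging.iter (fun i => blockAvg (P := F.P K) (j := i) (expMeanLogSU (n := Fin 2))) l W) c i : Matrix.specialUnitaryGroup (Fin 2) ℂ) : Matrix (Fin 2) (Fin 2) ℂ))
            * star ((corr (expMeanLogSU (n := Fin 2)) (Averaging.iter (fun i => blockAvg (P := F.P K) (j := i) (expMeanLogSU (n := Fin 2))) l W) c : Matrix.specialUnitaryGroup (Fin 2) ℂ) : Matrix (Fin 2) (Fin 2) ℂ)
          + ((corr (expMeanLogSU (n := Fin 2)) (Averaging.iter (fun i => blockAvg (P := F.P K) (j := i) (expMeanLogSU (n := Fin 2))) l W) c : Matrix.specialUnitaryGroup (Fin 2) ℂ) : Matrix (Fin 2) (Fin 2) ℂ)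
            * covWalkSum (Averaging.iter (fun i => blockAvg (P := F.P K) (j := i) (expMeanLogSU (n := Fin 2))) l W) (fun b => mlog (pertVar (Averaging.iter (fun i => blockAvg (P := F.P K) (j := i) (expMeanLogSU (n := Fin 2))) l W) (Averaging.iter (fun i => blockAvg (P := F.P K) (j := i) (expMeanLogSU (n := Fin 2))) l (emb15 W (expHermField D))) b + 1)) (walk (emb c.src) (List.replicate (F.P K).L (c.dir, true)))
            * star ((corr (expMeanLogSU (n := Fin 2)) (Averaging.iter (fun i => blockAvg (P := F.P K) (j := i) (expMeanLogSU (n := Fin 2))) l W) c : Matrix.specialUnitaryGroup (Fin 2) ℂ) : Matrix (Fin 2) (Fin 2) ℂ)))‖ with hr_def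
  set M : ℕ → ℝ := fun l => ∑ b : PBond (F.P K) l, ‖(pertVar (Averaging.iter (fun i => blockAvg (P := F.P K) (j := i) (expMeanLogSU (n := Fin 2))) l W) (Averaging.iter (fun i => blockAvg (P := F.P K) (j := i) (expMeanLogSU (n := Fin 2))) l (emb15 W (expHermField D)))) b‖ ^ 2 with hM_def
  have hr : ∀ l < K - n, r l ≤ (694800 * (F.L : ℝ) ^ 5) * M l := by
    intro l hl
    have h3 := Prop7LogRemainderMass.sum_norm_logRemainder_le_mass (P := F.P K) (N := 2) W (emb15 W (expHermField D)) l
      (by show l + 1 ≤ F.m + K; omega) (a := a l) (μ := 480 * (F.L : ℝ) ^ 4 * (F.L : ℝ) ^ l * s)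
      (hα l hl) (ha24 l hl) (hμ l hl) (hμ72 l hl) (by linarith [hμN l hl, ha24 l hl])
    refine h3.trans (le_of_eq ?_)
    rw [hM_def, hd]; push_cast; rw [hPL]; ring
  have hF4b := Prop7FibreLevelMassPerLevelT3.sum_normSq_levelRatio_le_LOnly_T3 F n K W (emb15 W (expHermField D)) he heL' hUe
    (fun j : ℕ => 480 * (F.L : ℝ) ^ 4 * (F.L : ℝ) ^ j * s) hμ0 hμ hμ72 hμN hθ0 hμθ hθL
  have hMl : ∀ l < K - n, M l ≤ 7 * (∑ b : PBond (F.P K) 0, ‖pertVar W (emb15 W (expHermField D)) b‖ ^ 2) * ((F.L : ℝ) ^ l)⁻¹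
      + ((28800 * (F.L : ℝ) ^ 4) * ((∑ x : Site (F.P K) 0, ∑ μ : Fin (F.P K).d, ∑ ν : Fin (F.P K).d,
            (if μ < ν then ∑ j : Fin 2, ∑ k : Fin 2,
              ‖(curl (torusT (F.P K) 0) (fun κ z => unitsField (toUField W) ⟨z, κ⟩) (fun κ z => pertVar W (emb15 W (expHermField D)) ⟨z, κ⟩) μ ν x) j k‖ ^ 2 else 0)) + (∑ x : Site (F.P K) 0, ∑ j : Fin 2, ∑ k : Fin 2,
            ‖(divB (torusT (F.P K) 0) (fun κ z => unitsField (toUField W) ⟨z, κ⟩) (fun κ z => pertVar W (emb15 W (expHermField D)) ⟨z, κ⟩) x) j k‖ ^ 2)) + (600000 * (F.L : ℝ) ^ 4) * 1 * (((((F.L : ℝ) ^ (K - n)))) ^ 2)⁻¹ * (∑ b : PBond (F.P K) 0, ‖pertVar W (emb15 W (expHermField D)) b‖ ^ 2)) * (F.L : ℝ) ^ l :=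
    fun l hl => (hF4b l hl.le).trans (le_of_eq (by rw [mul_one]))
  have hM00 : 0 ≤ (∑ b : PBond (F.P K) 0, ‖pertVar W (emb15 W (expHermField D)) b‖ ^ 2) := Finset.sum_nonneg fun _ _ => sq_nonneg _
  have hKD0 : 0 ≤ ((∑ x : Site (F.P K) 0, ∑ μ : Fin (F.P K).d, ∑ ν : Fin (F.P K).d,
            (if μ < ν then ∑ j : Fin 2, ∑ k : Fin 2,
              ‖(curl (torusT (F.P K) 0) (fun κ z => unitsField (toUField W) ⟨z, κ⟩) (fun κ z => pertVar W (emb15 W (expHermField D)) ⟨z, κ⟩) μ ν x) j k‖ ^ 2 else 0)) + (∑ x : Site (F.P K) 0, ∑ j : Fin 2, ∑ k : Fin 2,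
            ‖(divB (torusT (F.P K) 0) (fun κ z => unitsField (toUField W) ⟨z, κ⟩) (fun κ z => pertVar W (emb15 W (expHermField D)) ⟨z, κ⟩) x) j k‖ ^ 2)) := by positivity
  have hF4 := Prop7JointRowOfLevelMasses.jointRow_currency (F.L : ℝ) hL2 (K - n) (cA := 7) (cB := 28800 * (F.L : ℝ) ^ 4)
    (cB' := 600000 * (F.L : ℝ) ^ 4) (ε := 1) (C := 694800 * (F.L : ℝ) ^ 5) (E := 3 / 2)
    (by norm_num) (by positivity) (by positivity) (by norm_num) (by positivity) (by norm_num) hM00 hKD0 M r hMl hr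
  have hchain := hJ2.trans hF4
  -- the currency junction (§1)
  obtain ⟨hM0le, hKDle⟩ := currency_junction F hs4 W hUe D hD hs
  -- the witness `μ := −Λ_{K−n}`
  refine ⟨fun y => -Λ (K - n) y, fun y => ⟨?_, ?_⟩, ?_⟩
  · rw [skewAdjoint.mem_iff, star_neg, (hΛsu (K - n) le_rfl y).1]
  · rw [Matrix.trace_neg, (hΛsu (K - n) le_rfl y).2, neg_zero]
  have hsign : ∑ c : PBond (F.P K) (K - n), ‖Q (K - n) (fun b => Complex.I • D b) c
              - ((fun y => -Λ (K - n) y) c.src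
                - ((Averaging.iter (fun i => blockAvg (P := F.P K) (j := i) (expMeanLogSU (n := Fin 2))) (K - n) W c : Matrix.specialUnitaryGroup (Fin 2) ℂ) :
                    Matrix (Fin 2) (Fin 2) ℂ) * (fun y => -Λ (K - n) y) c.tgt
                  * star ((Averaging.iter (fun i => blockAvg (P := F.P K) (j := i) (expMeanLogSU (n := Fin 2))) (K - n) W c : Matrix.specialUnitaryGroup (Fin 2) ℂ) :
                    Matrix (Fin 2) (Fin 2) ℂ))‖
      = ∑ c : PBond (F.P K) (K - n), ‖Q (K - n) (fun b => Complex.I • D b) c + (Λ (K - n) c.src - ((Averaging.iter (fun i => blockAvg (P := F.P K) (j := i) (expMeanLogSU (n := Fin 2))) (K - n) W c : Matrix.specialUnitaryGroup (Fin 2) ℂ) : Matrix (Fin 2) (Fin 2) ℂ) * Λ (K - n) c.tgt * star ((Averaging.iter (fun i => blockAvg (P := F.P K) (j := i) (expMeanLogSU (n := Fin 2))) (K - n) W c : Matrix.specialUnitaryGroup (Fin 2) ℂ) : Matrix (Fin 2) (Fin 2) ℂ))‖ := by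
    refine Finset.sum_congr rfl fun c _ => ?_
    rw [sub_negGauge_eq]
  rw [hsign]
  refine hchain.trans ?_
  -- final bookkeeping (abstract atoms): `M₀ ≤ 2M`, `KD ≤ 8(K + DIV) + c_s·M`, `ℓ·c_s ≤ 322608·ℓ⁻¹`
  have hMd0 : 0 ≤ (∑ b : PBond (F.P K) 0, ‖D b‖ ^ 2) := Finset.sum_nonneg fun _ _ => sq_nonneg _
  have hL31 : 0 < (F.L : ℝ) ^ 3 - 1 := by nlinarith
  have hL11 : 0 < (F.L : ℝ) - 1 := by linarith
  have hcs := ell_mul_cs_le (e := e) hℓ1 hs0 hℓs1 he.le he1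
  have hb := bookkeeping (A₁ := ((3 / 2) * (694800 * (F.L : ℝ) ^ 5) * (7 * ((F.L : ℝ) ^ 2 / ((F.L : ℝ) - 1)) + 600000 * (F.L : ℝ) ^ 4 * 1 * ((F.L : ℝ) ^ 2 / ((F.L : ℝ) ^ 3 - 1)))))
    (A₂ := ((3 / 2) * (694800 * (F.L : ℝ) ^ 5) * (28800 * (F.L : ℝ) ^ 4) * ((F.L : ℝ) ^ 2 / ((F.L : ℝ) ^ 3 - 1)))) (by positivity) (by positivity) hℓpos hMd0 hM0le hKDle hcs le_rfl
  refine hb.trans (le_of_eq ?_)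
  ring

end Summit.QuantumFields.YangMills.Theorems.Prop7JointRowOfSuppliers

end
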